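import Summits.KontsevichZagierPeriods.KontsevichZagierPeriods.Theorems.SymplecticScissorsVolumeFormOffPlaneCertifiedPairs

/-!
# `VolumeFormOffPlane` (stmt-KontsevichZagierPeriods-14935) — line `Sketch`,
stub `stub_boxUnionPairs` (pairs of FINITE UNIONS of Λ-boxes, overlaps allowed)

Fix multiplicatively independent positive real algebraic numbers `α`, `β`, a positive
real-algebraic position lattice `t : Fin n → ℝ`, and finitely many Λ-boxes
`BOX i = {t_ι α^{pa i ι} β^{qa i ι} < x_ι < t_ι α^{pb i ι} β^{qb i ι}} × {0 < z, z · ∏ x_ι < 1}`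
(rational exponents; the boxes may overlap and may be empty). Two integrand-`1` representations
whose domains are such finite unions and whose values agree are KZ-equivalent.

Proof (bookkeeping over the landed certified-pairs interface `certifiedPairsFintype`):
* cells are indexed by `S : Finset (Fin k)`; for non-empty `S` the intersection `⋂ i ∈ S, BOX i`
  is again a log-box (coordinatewise maximal lower corner, minimal upper corner), in position
  form `{a_ι < x_ι < a_ι α^{u ι} β^{v ι}}` with `a` positive real algebraic, so it carries an
  integrand-`1` representation (`stub_logBoxCut.1`);
* weights `c S = (-1)^{|S|+1}` (`0` for `S = ∅`): the generic inclusion–exclusion identity for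
  indicator functions (a hypothesis of the stub) is exactly the required decomposition;
* certificates: if all edge ratios `α^{u ι} β^{v ι}` exceed `1` the cell is its own Λ-box
  (`d = 1`, one box), otherwise the cell is empty, hence a relation, and the empty certificate
  works.

Sources: M. Kontsevich, D. Zagier, *Periods* (2001), §1.2 (the moves); the bookkeeping is
folklore.
-/

noncomputable section

open MeasureTheory Set
open Literature.NumberTheory.Transcendental

namespace Summit.KontsevichZagierPeriods.SymplecticScissors.LogPolytope

/-! ## Intersections of log-boxes -/

/-- A non-empty finite intersection of log-boxes is the log-box whose lower corner is the
coordinatewise maximum of the lower corners (attained at `i₀ ι`) and whose upper corner is the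
coordinatewise minimum of the upper corners (attained at `j₀ ι`). [folklore] -/
theorem bup_biInter_logBox {n k : ℕ} (a b : Fin k → Fin n → ℝ) {S : Finset (Fin k)}
    (hS : S.Nonempty) (i₀ j₀ : Fin n → Fin k) (hi₀ : ∀ ι, i₀ ι ∈ S) (hj₀ : ∀ ι, j₀ ι ∈ S)
    (hmax : ∀ ι, ∀ i ∈ S, a i ι ≤ a (i₀ ι) ι) (hmin : ∀ ι, ∀ i ∈ S, b (j₀ ι) ι ≤ b i ι) :
    (⋂ i ∈ S, {p : Fin (n + 1) → ℝ | (∀ ι : Fin n, a i ι < p (Fin.castSucc ι) ∧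
      p (Fin.castSucc ι) < b i ι) ∧ 0 < p (Fin.last n) ∧
      p (Fin.last n) * ∏ ι : Fin n, p (Fin.castSucc ι) < 1}) =
    {p : Fin (n + 1) → ℝ | (∀ ι : Fin n, a (i₀ ι) ι < p (Fin.castSucc ι) ∧
      p (Fin.castSucc ι) < b (j₀ ι) ι) ∧ 0 < p (Fin.last n) ∧
      p (Fin.last n) * ∏ ι : Fin n, p (Fin.castSucc ι) < 1} := by
  ext p
  simp only [mem_iInter, mem_setOf_eq]
  refine ⟨fun h => ?_, fun h i hi => ?_⟩
  · obtain ⟨i, hi⟩ := hS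
    exact ⟨fun ι => ⟨((h _ (hi₀ ι)).1 ι).1, ((h _ (hj₀ ι)).1 ι).2⟩, (h i hi).2.1, (h i hi).2.2⟩
  · exact ⟨fun ι => ⟨(hmax ι i hi).trans_lt (h.1 ι).1, (h.1 ι).2.trans_le (hmin ι i hi)⟩,
      h.2.1, h.2.2⟩

/-! ## The cells: one integrand-`1` representation per non-empty index set -/

/-- For non-empty `S`, the intersection of the Λ-boxes `BOX i`, `i ∈ S`, is a log-box in position
form `{a_ι < x_ι < a_ι α^{u ι} β^{v ι}}` with `a` positive real algebraic and rational `u`, `v`,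
and it carries an integrand-`1` representation (`stub_logBoxCut.1`). [folklore] -/
theorem bup_cell {n : ℕ} {α β : ℝ} (hα : 0 < α) (hβ : 0 < β) (hαa : IsAlgebraic ℚ α)
    (hβa : IsAlgebraic ℚ β) {k : ℕ} {t : Fin n → ℝ} (pa qa pb qb : Fin k → Fin n → ℚ)
    (ht : ∀ ι, 0 < t ι) (hta : ∀ ι, IsAlgebraic ℚ (t ι)) {S : Finset (Fin k)}
    (hS : S.Nonempty) :
    ∃ (ρ : KZ.IntegralRep (n + 1)) (a : Fin n → ℝ) (u v : Fin n → ℚ),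
      (ρ.integrand = fun _ => 1) ∧ (∀ ι, 0 < a ι) ∧ (∀ ι, IsAlgebraic ℚ (a ι)) ∧
      ρ.domain = {ξ : Fin (n + 1) → ℝ | (∀ ι : Fin n, a ι < ξ (Fin.castSucc ι) ∧
        ξ (Fin.castSucc ι) < a ι * (α ^ ((u ι : ℚ) : ℝ) * β ^ ((v ι : ℚ) : ℝ))) ∧
        0 < ξ (Fin.last n) ∧ ξ (Fin.last n) * ∏ ι : Fin n, ξ (Fin.castSucc ι) < 1} ∧
      ρ.domain = ⋂ i ∈ S, {p : Fin (n + 1) → ℝ | (∀ ι : Fin n,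
        t ι * (α ^ ((pa i ι : ℚ) : ℝ) * β ^ ((qa i ι : ℚ) : ℝ)) < p (Fin.castSucc ι) ∧
        p (Fin.castSucc ι) < t ι * (α ^ ((pb i ι : ℚ) : ℝ) * β ^ ((qb i ι : ℚ) : ℝ))) ∧
        0 < p (Fin.last n) ∧ p (Fin.last n) * ∏ ι : Fin n, p (Fin.castSucc ι) < 1} := by
  have hcor : ∀ (ι : Fin n) (uu vv : ℚ),
      IsAlgebraic ℚ (t ι * (α ^ ((uu : ℚ) : ℝ) * β ^ ((vv : ℚ) : ℝ))) := fun ι uu vv =>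
    (hta ι).mul ((mxs_rpow_isAlgebraic hα hαa uu).mul (mxs_rpow_isAlgebraic hβ hβa vv))
  -- the coordinatewise extremal corners
  choose i₀ hi₀ hmax using fun ι : Fin n => Finset.exists_max_image S
    (fun i => t ι * (α ^ ((pa i ι : ℚ) : ℝ) * β ^ ((qa i ι : ℚ) : ℝ))) hS
  choose j₀ hj₀ hmin using fun ι : Fin n => Finset.exists_min_image S
    (fun i => t ι * (α ^ ((pb i ι : ℚ) : ℝ) * β ^ ((qb i ι : ℚ) : ℝ))) hS
  -- the upper corner in position form
  have hb : ∀ ι, t ι * (α ^ ((pa (i₀ ι) ι : ℚ) : ℝ) * β ^ ((qa (i₀ ι) ι : ℚ) : ℝ)) *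
      (α ^ (((pb (j₀ ι) ι - pa (i₀ ι) ι : ℚ)) : ℝ) * β ^ (((qb (j₀ ι) ι - qa (i₀ ι) ι : ℚ)) : ℝ)) =
      t ι * (α ^ ((pb (j₀ ι) ι : ℚ) : ℝ) * β ^ ((qb (j₀ ι) ι : ℚ) : ℝ)) := by
    intro ι
    rw [Rat.cast_sub, Rat.cast_sub, Real.rpow_sub hα, Real.rpow_sub hβ]
    have h1 : 0 < α ^ ((pa (i₀ ι) ι : ℚ) : ℝ) := Real.rpow_pos_of_pos hα _
    have h2 : 0 < β ^ ((qa (i₀ ι) ι : ℚ) : ℝ) := Real.rpow_pos_of_pos hβ _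
    field_simp
  have ha : ∀ ι, 0 < t ι * (α ^ ((pa (i₀ ι) ι : ℚ) : ℝ) * β ^ ((qa (i₀ ι) ι : ℚ) : ℝ)) :=
    fun ι => mul_pos (ht ι) (mul_pos (Real.rpow_pos_of_pos hα _) (Real.rpow_pos_of_pos hβ _))
  obtain ⟨ρ, hρd, hρi⟩ := stub_logBoxCut.1 n
    (fun ι => t ι * (α ^ ((pa (i₀ ι) ι : ℚ) : ℝ) * β ^ ((qa (i₀ ι) ι : ℚ) : ℝ)))
    (fun ι => t ι * (α ^ ((pa (i₀ ι) ι : ℚ) : ℝ) * β ^ ((qa (i₀ ι) ι : ℚ) : ℝ)) *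
      (α ^ (((pb (j₀ ι) ι - pa (i₀ ι) ι : ℚ)) : ℝ) * β ^ (((qb (j₀ ι) ι - qa (i₀ ι) ι : ℚ)) : ℝ)))
    ha (fun ι => hcor ι _ _) (fun ι => by rw [hb ι]; exact hcor ι _ _)
  refine ⟨ρ, fun ι => t ι * (α ^ ((pa (i₀ ι) ι : ℚ) : ℝ) * β ^ ((qa (i₀ ι) ι : ℚ) : ℝ)),
    fun ι => pb (j₀ ι) ι - pa (i₀ ι) ι, fun ι => qb (j₀ ι) ι - qa (i₀ ι) ι, hρi, ha,
    fun ι => hcor ι _ _, hρd, ?_⟩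
  rw [hρd, bup_biInter_logBox
    (fun i ι => t ι * (α ^ ((pa i ι : ℚ) : ℝ) * β ^ ((qa i ι : ℚ) : ℝ)))
    (fun i ι => t ι * (α ^ ((pb i ι : ℚ) : ℝ) * β ^ ((qb i ι : ℚ) : ℝ)))
    hS i₀ j₀ hi₀ hj₀ hmax hmin]
  simp only [hb]

/-! ## Certificates -/

/-- **Torsion certificate of a log-box in position form** (`d = 1`): an integrand-`1`
representation on `{a_ι < x_ι < a_ι α^{u ι} β^{v ι}}` (`a` positive real algebraic) is its own
Λ-box when every edge ratio exceeds `1`; otherwise the box is empty, the representation is a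
relation, and the empty certificate works. [folklore] -/
theorem bup_cert {n : ℕ} {α β : ℝ} {ρ : KZ.IntegralRep (n + 1)} {a : Fin n → ℝ}
    {u v : Fin n → ℚ} (hρi : ∀ ξ ∈ ρ.domain, ρ.integrand ξ = 1) (ha : ∀ ι, 0 < a ι)
    (haa : ∀ ι, IsAlgebraic ℚ (a ι))
    (hρd : ρ.domain = {ξ : Fin (n + 1) → ℝ | (∀ ι : Fin n, a ι < ξ (Fin.castSucc ι) ∧
        ξ (Fin.castSucc ι) < a ι * (α ^ ((u ι : ℚ) : ℝ) * β ^ ((v ι : ℚ) : ℝ))) ∧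
        0 < ξ (Fin.last n) ∧ ξ (Fin.last n) * ∏ ι : Fin n, ξ (Fin.castSucc ι) < 1}) :
    ∃ (d l : ℕ) (σ : Fin l → KZ.IntegralRep (n + 1)) (w : Fin l → ℤ), d ≠ 0 ∧
      (∀ j, w j ≠ 0 → ∃ (a : Fin n → ℝ) (u v : Fin n → ℚ),
        (∀ ξ ∈ (σ j).domain, (σ j).integrand ξ = 1) ∧ (∀ ι, 0 < a ι) ∧
        (∀ ι, IsAlgebraic ℚ (a ι)) ∧ (∀ ι, 1 < α ^ ((u ι : ℚ) : ℝ) * β ^ ((v ι : ℚ) : ℝ)) ∧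
        (σ j).domain = {ξ : Fin (n + 1) → ℝ | (∀ ι : Fin n, a ι < ξ (Fin.castSucc ι) ∧
          ξ (Fin.castSucc ι) < a ι * (α ^ ((u ι : ℚ) : ℝ) * β ^ ((v ι : ℚ) : ℝ))) ∧
          0 < ξ (Fin.last n) ∧ ξ (Fin.last n) * ∏ ι : Fin n, ξ (Fin.castSucc ι) < 1}) ∧
      d • KZ.of ρ - ∑ j, w j • KZ.of (σ j) ∈ KZ.relations := by
  by_cases hg : ∀ ι, 1 < α ^ ((u ι : ℚ) : ℝ) * β ^ ((v ι : ℚ) : ℝ)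
  · -- the box is its own certificate
    refine ⟨1, 1, fun _ => ρ, fun _ => 1, one_ne_zero,
      fun _ _ => ⟨a, u, v, hρi, ha, haa, hg, hρd⟩, ?_⟩
    simp only [one_smul, Fin.sum_univ_one, sub_self]
    exact zero_mem _
  · -- some edge ratio is `≤ 1`: the box is empty
    push Not at hg
    obtain ⟨ι, hι⟩ := hg
    have hempty : ρ.domain = ∅ := by
      rw [hρd]
      refine eq_empty_of_forall_notMem fun ξ hξ => ?_
      have h1 := (hξ.1 ι).1
      have h2 := (hξ.1 ι).2
      have h3 : a ι * (α ^ ((u ι : ℚ) : ℝ) * β ^ ((v ι : ℚ) : ℝ)) ≤ a ι :=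
        mul_le_of_le_one_right (ha ι).le hι
      linarith
    refine ⟨1, 0, fun j => j.elim0, fun j => j.elim0, one_ne_zero, fun j => j.elim0, ?_⟩
    simp only [one_smul, Finset.univ_eq_empty, Finset.sum_empty, sub_zero]
    exact KZ.of_mem_relations_of_volume_eq_zero ρ (by rw [hempty, measure_empty])

/-! ## One side: cells, weights, certificates and the decomposition -/

/-- **One side of the pair.** For a finite union `⋃ i, BOX i` of Λ-boxes over the position
lattice `t`: cells `ρ S` (`S : Finset (Fin k)`; for non-empty `S` an integrand-`1` representation
on `⋂ i ∈ S, BOX i`), inclusion–exclusion weights `c S = (-1)^{|S|+1}` (`0` for `S = ∅`), torsion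
certificates over Λ-boxes wherever `c S ≠ 0`, and the decomposition
`𝟙_{⋃ BOX i} = Σ_S c S · 𝟙_{dom ρ S}` (from the inclusion–exclusion identity, a hypothesis).
[folklore] -/
theorem bup_side {n : ℕ} {α β : ℝ} (hα : 0 < α) (hβ : 0 < β) (hαa : IsAlgebraic ℚ α)
    (hβa : IsAlgebraic ℚ β)
    (HIE : ∀ (X : Type) (k : ℕ) (A : Fin k → Set X) (x : X),
      (⋃ i, A i).indicator (fun _ => (1 : ℝ)) x =
      ∑ S : Finset (Fin k), (if S.Nonempty then (-1 : ℝ) ^ (S.card + 1) else 0) *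
      (⋂ i ∈ S, A i).indicator (fun _ => (1 : ℝ)) x)
    {k : ℕ} {t : Fin n → ℝ} (pa qa pb qb : Fin k → Fin n → ℚ) {r : KZ.IntegralRep (n + 1)}
    (ht : ∀ ι, 0 < t ι) (hta : ∀ ι, IsAlgebraic ℚ (t ι))
    (hr : r.domain = ⋃ i : Fin k, {p : Fin (n + 1) → ℝ | (∀ ι : Fin n,
        t ι * (α ^ ((pa i ι : ℚ) : ℝ) * β ^ ((qa i ι : ℚ) : ℝ)) < p (Fin.castSucc ι) ∧
        p (Fin.castSucc ι) < t ι * (α ^ ((pb i ι : ℚ) : ℝ) * β ^ ((qb i ι : ℚ) : ℝ))) ∧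
        0 < p (Fin.last n) ∧ p (Fin.last n) * ∏ ι : Fin n, p (Fin.castSucc ι) < 1}) :
    ∃ (ρ : Finset (Fin k) → KZ.IntegralRep (n + 1)) (c : Finset (Fin k) → ℤ),
      (∀ S, ∀ ξ ∈ (ρ S).domain, (ρ S).integrand ξ = 1) ∧
      (∀ S, c S ≠ 0 → ∃ (d l : ℕ) (σ : Fin l → KZ.IntegralRep (n + 1)) (w : Fin l → ℤ), d ≠ 0 ∧
        (∀ j, w j ≠ 0 → ∃ (a : Fin n → ℝ) (u v : Fin n → ℚ),
          (∀ ξ ∈ (σ j).domain, (σ j).integrand ξ = 1) ∧ (∀ ι, 0 < a ι) ∧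
          (∀ ι, IsAlgebraic ℚ (a ι)) ∧ (∀ ι, 1 < α ^ ((u ι : ℚ) : ℝ) * β ^ ((v ι : ℚ) : ℝ)) ∧
          (σ j).domain = {ξ : Fin (n + 1) → ℝ | (∀ ι : Fin n, a ι < ξ (Fin.castSucc ι) ∧
            ξ (Fin.castSucc ι) < a ι * (α ^ ((u ι : ℚ) : ℝ) * β ^ ((v ι : ℚ) : ℝ))) ∧
            0 < ξ (Fin.last n) ∧ ξ (Fin.last n) * ∏ ι : Fin n, ξ (Fin.castSucc ι) < 1}) ∧
        d • KZ.of (ρ S) - ∑ j, w j • KZ.of (σ j) ∈ KZ.relations) ∧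
      (∀ᵐ x : Fin (n + 1) → ℝ, r.domain.indicator (fun _ => (1 : ℝ)) x =
        ∑ S, (c S : ℝ) * (ρ S).domain.indicator (fun _ => (1 : ℝ)) x) := by
  -- a dummy cell for `S = ∅` (its weight is `0`)
  obtain ⟨r₀, -, hr₀i⟩ := stub_logBoxCut.1 n (fun _ => 1) (fun _ => 1) (fun _ => one_pos)
    (fun _ => isAlgebraic_one) (fun _ => isAlgebraic_one)
  have hcell : ∀ S : Finset (Fin k), ∃ ρ : KZ.IntegralRep (n + 1), (ρ.integrand = fun _ => 1) ∧
      (S.Nonempty → ∃ (a : Fin n → ℝ) (u v : Fin n → ℚ), (∀ ι, 0 < a ι) ∧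
        (∀ ι, IsAlgebraic ℚ (a ι)) ∧
        ρ.domain = {ξ : Fin (n + 1) → ℝ | (∀ ι : Fin n, a ι < ξ (Fin.castSucc ι) ∧
          ξ (Fin.castSucc ι) < a ι * (α ^ ((u ι : ℚ) : ℝ) * β ^ ((v ι : ℚ) : ℝ))) ∧
          0 < ξ (Fin.last n) ∧ ξ (Fin.last n) * ∏ ι : Fin n, ξ (Fin.castSucc ι) < 1} ∧
        ρ.domain = ⋂ i ∈ S, {p : Fin (n + 1) → ℝ | (∀ ι : Fin n,
          t ι * (α ^ ((pa i ι : ℚ) : ℝ) * β ^ ((qa i ι : ℚ) : ℝ)) < p (Fin.castSucc ι) ∧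
          p (Fin.castSucc ι) < t ι * (α ^ ((pb i ι : ℚ) : ℝ) * β ^ ((qb i ι : ℚ) : ℝ))) ∧
          0 < p (Fin.last n) ∧ p (Fin.last n) * ∏ ι : Fin n, p (Fin.castSucc ι) < 1}) := by
    intro S
    by_cases hS : S.Nonempty
    · obtain ⟨ρ, a, u, v, hρi, ha, haa, hρd, hρS⟩ :=
        bup_cell hα hβ hαa hβa pa qa pb qb ht hta hS
      exact ⟨ρ, hρi, fun _ => ⟨a, u, v, ha, haa, hρd, hρS⟩⟩
    · exact ⟨r₀, hr₀i, fun h => (hS h).elim⟩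
  choose ρ hρi hρS using hcell
  refine ⟨ρ, fun S => if S.Nonempty then (-1) ^ (S.card + 1) else 0,
    fun S ξ _ => by rw [hρi S], fun S hS => ?_, ?_⟩
  · -- certificates (only non-empty `S` have non-zero weight)
    have hSne : S.Nonempty := by
      by_contra h
      exact hS (by simp [h])
    obtain ⟨a, u, v, ha, haa, hρd, -⟩ := hρS S hSne
    exact bup_cert (fun ξ _ => by rw [hρi S]) ha haa hρd
  · -- the decomposition holds everywhere: inclusion–exclusion for indicator functions
    refine Filter.Eventually.of_forall fun x => ?_
    rw [hr]
    refine (HIE _ k _ x).trans (Finset.sum_congr rfl fun S _ => ?_)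
    by_cases hSne : S.Nonempty
    · obtain ⟨a, u, v, -, -, -, hρdS⟩ := hρS S hSne
      rw [← hρdS]
      simp [hSne]
    · simp [hSne]

/-! ## The stub -/

/-- **Stub (BOX-UNION PAIRS).** Two integrand-`1` representations whose domains are finite
unions of Λ-boxes `{t_ι α^{pa i ι} β^{qa i ι} < x_ι < t_ι α^{pb i ι} β^{qb i ι}} × {0 < z, z∏x < 1}`
over a common positive real-algebraic position lattice `t` (rational exponents, overlaps and
empty boxes allowed) and whose values agree are KZ-equivalent — `certifiedPairsFintype` with
cells the intersections `⋂ i ∈ S, BOX i` (again Λ-boxes), inclusion–exclusion weights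
`(-1)^{|S|+1}` (the indicator identity is the hypothesis), and the trivial box certificates.
[folklore] -/
theorem stub_boxUnionPairs : ∀ (n : ℕ) (α β : ℝ), 0 < α → 0 < β → IsAlgebraic ℚ α → IsAlgebraic ℚ β →
    (∀ p q : ℤ, α ^ p * β ^ q = 1 → p = 0 ∧ q = 0) →
    (∀ (X : Type) (k : ℕ) (A : Fin k → Set X) (x : X),
      (⋃ i, A i).indicator (fun _ => (1 : ℝ)) x =
      ∑ S : Finset (Fin k), (if S.Nonempty then (-1 : ℝ) ^ (S.card + 1) else 0) *
      (⋂ i ∈ S, A i).indicator (fun _ => (1 : ℝ)) x) →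
    ∀ (k k' : ℕ) (t : Fin n → ℝ) (pa qa pb qb : Fin k → Fin n → ℚ)
      (pa' qa' pb' qb' : Fin k' → Fin n → ℚ) (r r' : KZ.IntegralRep (n + 1)),
    (∀ ι, 0 < t ι) → (∀ ι, IsAlgebraic ℚ (t ι)) →
    r.domain = ⋃ i : Fin k, {p : Fin (n + 1) → ℝ | (∀ ι : Fin n, t ι * (α ^ ((pa i ι : ℚ) : ℝ) * β ^ ((qa i ι : ℚ) : ℝ)) < p (Fin.castSucc ι) ∧
        p (Fin.castSucc ι) < t ι * (α ^ ((pb i ι : ℚ) : ℝ) * β ^ ((qb i ι : ℚ) : ℝ))) ∧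
        0 < p (Fin.last n) ∧ p (Fin.last n) * ∏ ι : Fin n, p (Fin.castSucc ι) < 1} →
    r'.domain = ⋃ i : Fin k', {p : Fin (n + 1) → ℝ | (∀ ι : Fin n, t ι * (α ^ ((pa' i ι : ℚ) : ℝ) * β ^ ((qa' i ι : ℚ) : ℝ)) < p (Fin.castSucc ι) ∧
        p (Fin.castSucc ι) < t ι * (α ^ ((pb' i ι : ℚ) : ℝ) * β ^ ((qb' i ι : ℚ) : ℝ))) ∧
        0 < p (Fin.last n) ∧ p (Fin.last n) * ∏ ι : Fin n, p (Fin.castSucc ι) < 1} →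
    (∀ p ∈ r.domain, r.integrand p = 1) → (∀ p ∈ r'.domain, r'.integrand p = 1) →
    r.value = r'.value → KZ.Equivalent r r' := by
  intro n α β hα hβ hαa hβa hind HIE k k' t pa qa pb qb pa' qa' pb' qb' r r' ht hta hr hr'
    hr1 hr1' hval
  obtain ⟨ρ, c, hρ, hc, hdec⟩ := bup_side hα hβ hαa hβa HIE pa qa pb qb ht hta hr
  obtain ⟨ρ', c', hρ', hc', hdec'⟩ := bup_side hα hβ hαa hβa HIE pa' qa' pb' qb' ht hta hr'
  exact certifiedPairsFintype n α β hα hβ hαa hβa hind (Finset (Fin k)) (Finset (Fin k')) r r'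
    ρ ρ' c c' hr1 hr1' hρ hρ' hc hc' hdec hdec' hval

end Summit.KontsevichZagierPeriods.SymplecticScissors.LogPolytope

end
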